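import Mathlib.Analysis.InnerProductSpace.Harmonic.Basic
import Mathlib.Analysis.Calculus.ParametricIntegral
import Mathlib.MeasureTheory.Measure.Haar.NormedSpace
import Mathlib.MeasureTheory.Integral.IntervalIntegral.FundThmCalculus
import Literature.Analysis.FluidPDE.HarmonicMeanValue
import Literature.Analysis.FluidPDE.HarmonicProbe
import Literature.Analysis.FluidPDE.WholeSpaceIBP
import HarnessLib

/-!
# The mean value defect of a `C²` function and the sub-mean-value inequality

Analysis/FluidPDE support file: the one-sided twin of the weighted mean value property
`Literature.Analysis.FluidPDE.integral_radial_mul_harmonic` (`FluidPDE/HarmonicMeanValue`, Gilbarg–Trudinger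
Thm 2.1 in weighted radial form).

Let `E` be a finite-dimensional real inner product space with its Lebesgue measure, `η : E → ℝ` of class `C²`,
and `w : E → ℝ` a continuous compactly supported weight which is a RADIAL GRADIENT: there is a `C¹`
compactly supported `P` with `DP(y) = w(y) ⟨y, ·⟩` (for a radial `w` this is `exists_radial_primitive`; for a
radial `w ≥ 0` vanishing off the ball of radius `ρ` the canonical primitive is `≤ 0` with
`|P(y)| ≤ ½ (sup w) (ρ² − |y|²)⁺`, `exists_radial_primitive_nonpos` below).  We prove the EXACT MEAN VALUE
DEFECT IDENTITY

  `∫ w(y) η(x₀ + y) dy − (∫ w) η(x₀) = −∫₀¹ s ∫ P(y) (Δη)(x₀ + s y) dy ds`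

(`integral_mul_comp_add_sub_integral_mul_eq`), from which: `Δη = 0` gives the mean value property again;
`P ≤ 0` and `Δη ≥ −f` with `f` continuous give the SUB-MEAN-VALUE INEQUALITY WITH DEFECT

  `(∫ w) η(x₀) ≤ ∫ w(y) η(x₀ + y) dy + ∫₀¹ s ∫ |P(y)| f(x₀ + s y) dy ds`

(`integral_mul_le_integral_mul_comp_add_add`; for `f = 0` this is Gilbarg–Trudinger Thm 2.1 for subharmonic
functions, `Δη ≥ 0 ⇒ η(x₀) ≤` weighted average), and its unit-mass form for the tree's radial probe bumps
`probeBump R` (`le_integral_probeBump_mul_comp_add_add`: `η(x₀) ≤ ∫ χ_R(y) η(x₀+y) dy + ∫₀¹ s∫ Q(y) f(x₀+sy) dy ds`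
with an explicit `0 ≤ Q ≤ 2R²(m R^d)⁻¹` vanishing off `|y| < 2R`).  After the substitution `z = s y` the defect is
the truncated Newtonian potential `≍ ∫_{B_{2R}(x₀)} f(z) ‖z − x₀‖^{2−d} dz` of `f`; that kernel form is left to the
consumers (the two-scale bounds are elementary from the `s`-form).

## Proof

As in `HarmonicMeanValue`: `J(s) := ∫ w(y) η(x₀ + s y) dy` has derivative `J′(s) = ∫ w(y) Dη(x₀ + s y)[y] dy`
(differentiation under the integral sign, `hasDerivAt_integral_mul_comp_add_smul`).  For `s ≠ 0`, applying to
`η_s := η(x₀ + s ·)` the CORE IDENTITY WITH LAPLACIAN `∫ w(y) Dη_s(y)[y] dy = ∫ ⟨∇P, ∇η_s⟩ = −∫ P Δη_s` (Green's first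
identity without boundary terms, `FluidPDE.integral_inner_laplacian_add_eq_zero`, keeping the Laplacian term which
`integral_radial_mul_fderiv_apply_self_eq_zero` discarded) and `Dη_s(y)[y] = s Dη(x₀+sy)[y]`, `Δη_s(y) = s²(Δη)(x₀+sy)`
gives `J′(s) = −s ∫ P(y) (Δη)(x₀ + s y) dy`; then `J(1) − J(0) = ∫₀¹ J′` (the formula is only needed on `(0,1)`).

## Main statements

* `exists_radial_primitive_nonpos`: signed and sized radial primitive of a radial weight `w ≥ 0`.
  (Differentiation under the integral sign, the `J′` formula and the continuity of the parametric integrals are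
  private plumbing.)
* `integral_radial_mul_fderiv_apply_self_eq_neg_integral_mul_laplacian`: the core identity with Laplacian.
* `integral_mul_comp_add_sub_integral_mul_eq`: the mean value defect identity.
* `integral_mul_le_integral_mul_comp_add_add`: the sub-mean-value inequality with defect (`Δη ≥ −f`).
* `le_integral_probeBump_mul_comp_add_add`: its unit-mass probe-bump form.

WHAT THIS IS NOT: no boundary / sphere averages (the tree has no divergence theorem on balls; everything is
boundary-free), no maximum principle, no kernel (`‖z − x₀‖^{2−d}`) form.

## References

* D. Gilbarg, N. S. Trudinger, *Elliptic partial differential equations of second order* (Springer, 2001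
  reprint), Thm 2.1 (mean value (in)equalities for `Δu = 0 (≥ 0, ≤ 0)`), §2.4 (Green's representation).
-/

noncomputable section

open MeasureTheory Set Filter Metric Topology InnerProductSpace Function
open scoped RealInnerProductSpace Laplacian

namespace Literature.Analysis.FluidPDE

variable {E : Type*} [NormedAddCommGroup E] [InnerProductSpace ℝ E] [FiniteDimensional ℝ E]

/-! ### The signed radial primitive of a nonnegative radial weight -/

-- adapted from `exists_radial_primitive` (FluidPDE/HarmonicMeanValue): same construction, sign and size recorded
/-- **Radial fields are gradients, signed form.**  A continuous radial `w : E → ℝ` with `0 ≤ w ≤ M`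
vanishing for `‖x‖ ≥ ρ` (`ρ > 0`) admits a compactly supported `C¹` function `P` with
`DP(y) = w(y) ⟨y, ·⟩`, namely `P(y) = ½ ∫_{ρ²}^{‖y‖²} φ` with `φ(τ) = w(√τ e)` the radial profile; this `P`
is `≤ 0`, vanishes for `‖y‖ ≥ ρ`, and `−P(y) ≤ (M/2)(ρ² − ‖y‖²)` on `‖y‖ ≤ ρ`, `−P ≤ (M/2) ρ²` everywhere
(the radial potential of the weighted, boundary-free form of the proof of the mean value inequality, Gilbarg–Trudinger
Thm 2.1; signed refinement of the tree's `exists_radial_primitive`). [cite: GilbargTrudinger2001, Thm 2.1] -/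
theorem exists_radial_primitive_nonpos {w : E → ℝ} (hw : Continuous w)
    (hrad : ∀ x y, ‖x‖ = ‖y‖ → w x = w y) (h0 : ∀ x, 0 ≤ w x) {M : ℝ} (hM : ∀ x, w x ≤ M)
    {ρ : ℝ} (hρ : 0 < ρ) (hwρ : ∀ x, ρ ≤ ‖x‖ → w x = 0) :
    ∃ P : E → ℝ, ContDiff ℝ 1 P ∧ HasCompactSupport P ∧
      (∀ y, HasFDerivAt P (w y • (innerSL ℝ y : E →L[ℝ] ℝ)) y) ∧
      (∀ y, P y ≤ 0) ∧ (∀ y, ρ ≤ ‖y‖ → P y = 0) ∧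
      (∀ y, ‖y‖ ≤ ρ → -P y ≤ M / 2 * (ρ ^ 2 - ‖y‖ ^ 2)) ∧ (∀ y, -P y ≤ M / 2 * ρ ^ 2) := by
  have hM0 : 0 ≤ M := (h0 0).trans (hM 0)
  rcases subsingleton_or_nontrivial E with hE | hE
  · refine ⟨0, contDiff_const, HasCompactSupport.zero, fun y => ?_, fun _ => le_rfl, fun _ _ => rfl,
      fun y hy => ?_, fun y => ?_⟩
    · have hy : y = 0 := Subsingleton.elim y 0
      rw [hy, map_zero, smul_zero]
      exact hasFDerivAt_const (0 : ℝ) 0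
    · have hy0 : y = 0 := Subsingleton.elim y 0
      simp only [Pi.zero_apply, neg_zero, hy0, norm_zero]
      nlinarith
    · simp only [Pi.zero_apply, neg_zero]
      positivity
  -- a unit vector and the radial profile
  obtain ⟨e, he⟩ : ∃ e : E, ‖e‖ = 1 := exists_norm_eq E zero_le_one
  set φ : ℝ → ℝ := fun τ => w (Real.sqrt τ • e) with hφ_def
  have hφ : Continuous φ := hw.comp (Real.continuous_sqrt.smul continuous_const)
  have hφw : ∀ y : E, φ (‖y‖ ^ 2) = w y := fun y => by
    refine hrad _ _ ?_
    rw [norm_smul, he, mul_one, Real.norm_eq_abs, Real.sqrt_sq (norm_nonneg _),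
      abs_of_nonneg (norm_nonneg _)]
  have hφ0' : ∀ τ, 0 ≤ φ τ := fun τ => h0 _
  have hφM : ∀ τ, φ τ ≤ M := fun τ => hM _
  have hφ0 : ∀ τ, ρ ^ 2 ≤ τ → φ τ = 0 := fun τ hτ => by
    refine hwρ _ ?_
    rw [norm_smul, he, mul_one, Real.norm_eq_abs, abs_of_nonneg (Real.sqrt_nonneg _)]
    calc ρ = Real.sqrt (ρ ^ 2) := (Real.sqrt_sq hρ.le).symm
      _ ≤ Real.sqrt τ := Real.sqrt_le_sqrt hτ
  -- the primitive of the profile, its monotonicity and Lipschitz bound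
  set Q : ℝ → ℝ := fun σ => ∫ τ in (0 : ℝ)..σ, φ τ with hQ_def
  have hQ : ∀ σ, HasDerivAt Q (φ σ) σ := fun σ => (hφ.integral_hasStrictDerivAt 0 σ).hasDerivAt
  have hi : ∀ a b : ℝ, IntervalIntegrable φ volume a b := fun a b => hφ.intervalIntegrable a b
  have hQsub : ∀ σ σ' : ℝ, Q σ' - Q σ = ∫ τ in σ..σ', φ τ := fun σ σ' => by
    simp only [hQ_def]
    rw [intervalIntegral.integral_interval_sub_left (hi _ _) (hi _ _)]
  have hQmono : ∀ σ σ' : ℝ, σ ≤ σ' → 0 ≤ Q σ' - Q σ := fun σ σ' h => by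
    rw [hQsub]
    exact intervalIntegral.integral_nonneg h fun τ _ => hφ0' τ
  have hQlip : ∀ σ σ' : ℝ, σ ≤ σ' → Q σ' - Q σ ≤ M * (σ' - σ) := fun σ σ' h => by
    rw [hQsub]
    have h1 : ‖∫ τ in σ..σ', φ τ‖ ≤ M * |σ' - σ| :=
      intervalIntegral.norm_integral_le_of_norm_le_const fun τ _ => by
        rw [Real.norm_eq_abs, abs_of_nonneg (hφ0' τ)]
        exact hφM τ
    rw [abs_of_nonneg (sub_nonneg.2 h), Real.norm_eq_abs] at h1
    exact (le_abs_self _).trans h1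
  have hQρ : ∀ σ, ρ ^ 2 ≤ σ → Q σ = Q (ρ ^ 2) := fun σ hσ => by
    have h2 : ∫ τ in (ρ ^ 2)..σ, φ τ = 0 := by
      rw [← intervalIntegral.integral_zero (a := ρ ^ 2) (b := σ) (μ := volume)]
      refine intervalIntegral.integral_congr fun τ hτ => ?_
      rw [uIcc_of_le hσ] at hτ
      exact hφ0 τ hτ.1
    have h1 := hQsub (ρ ^ 2) σ
    linarith
  -- the primitive on `E`
  set P : E → ℝ := fun y => 2⁻¹ * (Q (‖y‖ ^ 2) - Q (ρ ^ 2)) with hP_def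
  have hP : ∀ y, HasFDerivAt P (w y • (innerSL ℝ y : E →L[ℝ] ℝ)) y := fun y => by
    have h1 : HasFDerivAt (fun y : E => ‖y‖ ^ 2) (2 • (innerSL ℝ y : E →L[ℝ] ℝ)) y :=
      (hasStrictFDerivAt_norm_sq y).hasFDerivAt
    have h2 : HasFDerivAt (fun y : E => Q (‖y‖ ^ 2))
        (φ (‖y‖ ^ 2) • (2 • (innerSL ℝ y : E →L[ℝ] ℝ))) y := by
      have := (hQ (‖y‖ ^ 2)).comp_hasFDerivAt y h1
      simpa only [Function.comp_def] using this
    have h3 := ((h2.sub_const (Q (ρ ^ 2))).const_mul 2⁻¹)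
    refine h3.congr_fderiv ?_
    ext v
    simp only [_root_.FunLike.coe_smul, Pi.smul_apply, smul_eq_mul, hφw y]
    ring
  have hP0 : ∀ y, ρ ≤ ‖y‖ → P y = 0 := fun y hy => by
    have : ρ ^ 2 ≤ ‖y‖ ^ 2 := pow_le_pow_left₀ hρ.le hy 2
    simp [hP_def, hQρ _ this]
  have hP0' : ∀ y, y ∉ closedBall (0 : E) ρ → P y = 0 := fun y hy => by
    rw [mem_closedBall_zero_iff, not_le] at hy
    exact hP0 y hy.le
  have hPc : HasCompactSupport P := HasCompactSupport.intro (isCompact_closedBall 0 ρ) hP0'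
  have hPle : ∀ y, P y ≤ 0 := fun y => by
    rcases le_total (‖y‖ ^ 2) (ρ ^ 2) with h | h
    · have := hQmono _ _ h
      simp only [hP_def]
      linarith
    · simp [hP_def, hQρ _ h]
  have hPfine : ∀ y, ‖y‖ ≤ ρ → -P y ≤ M / 2 * (ρ ^ 2 - ‖y‖ ^ 2) := fun y hy => by
    have h : ‖y‖ ^ 2 ≤ ρ ^ 2 := pow_le_pow_left₀ (norm_nonneg _) hy 2
    have := hQlip _ _ h
    simp only [hP_def]
    linarith
  have hPcoarse : ∀ y, -P y ≤ M / 2 * ρ ^ 2 := fun y => by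
    rcases le_total ‖y‖ ρ with h | h
    · have := hPfine y h
      nlinarith [sq_nonneg ‖y‖]
    · rw [hP0 y h, neg_zero]
      positivity
  have hcont : Continuous fun y : E => w y • (innerSL ℝ y : E →L[ℝ] ℝ) :=
    hw.smul (innerSL ℝ (E := E)).continuous
  exact ⟨P, contDiff_one_iff_hasFDerivAt.2 ⟨_, hcont, hP⟩, hPc, hP, hPle, hP0, hPfine, hPcoarse⟩

/-! ### The core identity, keeping the Laplacian -/

section Volume

variable [MeasurableSpace E] [BorelSpace E]

-- adapted from `integral_radial_mul_fderiv_apply_self_eq_zero` (FluidPDE/HarmonicMeanValue): Green without `Δη = 0`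
/-- **Core identity with Laplacian.**  For `η ∈ C²(E)` and a weight `w` with a `C¹` compactly supported primitive
`P`, `DP(y) = w(y) ⟨y, ·⟩`: `∫ w(y) Dη(y)[y] dy = ∫ ⟨∇P, ∇η⟩ = −∫ P Δη` (Green's first identity without boundary
terms, `FluidPDE.integral_inner_laplacian_add_eq_zero`). [cite: GilbargTrudinger2001, Thm 2.1] -/
theorem integral_radial_mul_fderiv_apply_self_eq_neg_integral_mul_laplacian {η w P : E → ℝ}
    (hη : ContDiff ℝ 2 η) (hP1 : ContDiff ℝ 1 P) (hPc : HasCompactSupport P)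
    (hP : ∀ y, HasFDerivAt P (w y • (innerSL ℝ y : E →L[ℝ] ℝ)) y) :
    ∫ y, w y * fderiv ℝ η y y = -∫ y, P y * (Δ η) y := by
  set b := stdOrthonormalBasis ℝ E
  have hη1 : ContDiff ℝ 1 η := hη.of_le one_le_two
  -- Green's first identity: `∫ Δη P + Σᵢ ∫ ∂ᵢη ∂ᵢP = 0`
  have green := FluidPDE.integral_inner_laplacian_add_eq_zero b hη hP1 (Or.inr hPc)
  have h0 : (∫ x, ⟪(Δ η) x, P x⟫) = ∫ y, P y * (Δ η) y := by
    refine integral_congr_ae (Eventually.of_forall fun x => ?_)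
    simp only [RCLike.inner_apply, conj_trivial]
  rw [h0] at green
  -- the integrand is the sum over the basis
  have hfd : ∀ y, fderiv ℝ P y = w y • (innerSL ℝ y : E →L[ℝ] ℝ) := fun y => (hP y).fderiv
  have key : ∀ y, w y * fderiv ℝ η y y =
      ∑ i, ⟪fderiv ℝ η y (b i), fderiv ℝ P y (b i)⟫ := fun y => by
    have hs : fderiv ℝ η y y = ∑ i, ⟪b i, y⟫ * fderiv ℝ η y (b i) := by
      have : fderiv ℝ η y y = fderiv ℝ η y (∑ i, ⟪b i, y⟫ • b i) := by rw [b.sum_repr' y]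
      rw [this, map_sum]
      simp only [map_smul, smul_eq_mul]
    rw [hs, Finset.mul_sum]
    refine Finset.sum_congr rfl fun i _ => ?_
    rw [hfd y]
    simp only [_root_.FunLike.coe_smul, Pi.smul_apply, innerSL_apply_apply, smul_eq_mul]
    simp only [RCLike.inner_apply, conj_trivial]
    rw [real_inner_comm]
    ring
  have hint : ∀ i, Integrable (fun y => ⟪fderiv ℝ η y (b i), fderiv ℝ P y (b i)⟫)
      (volume : Measure E) := fun i => by
    refine Continuous.integrable_of_hasCompactSupport ?_ ?_
    · exact (((hη1.continuous_fderiv one_ne_zero).clm_apply continuous_const)).inner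
        ((hP1.continuous_fderiv one_ne_zero).clm_apply continuous_const)
    · exact (hPc.fderiv_apply (𝕜 := ℝ) (b i)).mono fun y hy => by
        contrapose! hy
        simp only [mem_support, not_not] at hy
        simp [hy]
  simp_rw [key]
  rw [integral_finsetSum _ fun i _ => hint i]
  linarith

/-! ### The one-parameter family `J(s) = ∫ w(y) η(x₀ + s y) dy` -/

-- adapted from Step 1 of `integral_radial_mul_harmonic` (FluidPDE/HarmonicMeanValue), `C¹` suffices
/-- **Differentiation under the integral sign.**  For `η ∈ C¹(E)` and a continuous compactly supported weight
`w`, `J(s) := ∫ w(y) η(x₀ + s y) dy` has derivative `J′(s) = ∫ w(y) Dη(x₀ + s y)[y] dy` at every `s`. [folklore] -/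
private theorem hasDerivAt_integral_mul_comp_add_smul {η w : E → ℝ} (hη : ContDiff ℝ 1 η)
    (hw : Continuous w) (hc : HasCompactSupport w) (x₀ : E) (s : ℝ) :
    HasDerivAt (fun s : ℝ => ∫ y, w y * η (x₀ + s • y)) (∫ y, w y * fderiv ℝ η (x₀ + s • y) y) s := by
  have hηc : Continuous η := hη.continuous
  have hDηc : Continuous (fderiv ℝ η) := hη.continuous_fderiv one_ne_zero
  have hηd : ∀ z, HasFDerivAt η (fderiv ℝ η z) z := fun z =>
    (hη.differentiable one_ne_zero z).hasFDerivAt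
  -- support radius of `w`
  obtain ⟨ρ, hρ, hρw⟩ : ∃ ρ : ℝ, 0 < ρ ∧ tsupport w ⊆ ball (0 : E) ρ :=
    hc.isCompact.isBounded.subset_ball_lt 0 0
  have hw0 : ∀ y : E, ρ ≤ ‖y‖ → w y = 0 := fun y hy =>
    image_eq_zero_of_notMem_tsupport fun h => by
      have := hρw h
      rw [mem_ball_zero_iff] at this
      linarith
  -- a bound for `∇η` on the relevant compact set
  obtain ⟨C, hC⟩ := (isCompact_closedBall x₀ ((|s| + 1) * ρ)).exists_bound_of_continuousOn
    hDηc.continuousOn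
  have hC0 : 0 ≤ C := le_trans (norm_nonneg _) (hC x₀ (mem_closedBall_self (by positivity)))
  have haff : ∀ s' : ℝ, Continuous fun y : E => x₀ + s' • y := fun s' =>
    continuous_const.add (continuous_id.const_smul s')
  have hFc : ∀ s', Continuous fun y => w y * η (x₀ + s' • y) := fun s' =>
    hw.mul (hηc.comp (haff s'))
  have hF_meas : ∀ s', AEStronglyMeasurable (fun y => w y * η (x₀ + s' • y))
      (volume : Measure E) := fun s' => (hFc s').aestronglyMeasurable
  have hF_int : Integrable (fun y => w y * η (x₀ + s • y)) (volume : Measure E) :=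
    (hFc s).integrable_of_hasCompactSupport hc.mul_right
  have hF'c : Continuous fun y => w y * fderiv ℝ η (x₀ + s • y) y :=
    hw.mul ((hDηc.comp (haff s)).clm_apply continuous_id)
  have hF'_meas : AEStronglyMeasurable (fun y => w y * fderiv ℝ η (x₀ + s • y) y)
      (volume : Measure E) := hF'c.aestronglyMeasurable
  have h_bound : ∀ᵐ y ∂(volume : Measure E), ∀ s' ∈ ball s 1,
      ‖w y * fderiv ℝ η (x₀ + s' • y) y‖ ≤ C * ρ * |w y| := by
    refine Eventually.of_forall fun y s' hs' => ?_
    rcases le_or_gt ρ ‖y‖ with hy | hy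
    · simp [hw0 y hy]
    · have hmem : x₀ + s' • y ∈ closedBall x₀ ((|s| + 1) * ρ) := by
        rw [mem_closedBall, dist_eq_norm, add_sub_cancel_left, norm_smul, Real.norm_eq_abs]
        have hs'1 : |s'| ≤ |s| + 1 := by
          rw [mem_ball, Real.dist_eq] at hs'
          have := abs_sub_abs_le_abs_sub s' s
          linarith
        exact mul_le_mul hs'1 hy.le (norm_nonneg _) (by positivity)
      rw [norm_mul, Real.norm_eq_abs]
      calc |w y| * ‖fderiv ℝ η (x₀ + s' • y) y‖
          ≤ |w y| * (C * ρ) := by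
            refine mul_le_mul_of_nonneg_left ?_ (abs_nonneg _)
            calc ‖fderiv ℝ η (x₀ + s' • y) y‖ ≤ ‖fderiv ℝ η (x₀ + s' • y)‖ * ‖y‖ :=
                  ContinuousLinearMap.le_opNorm _ _
              _ ≤ C * ρ := mul_le_mul (hC _ hmem) hy.le (norm_nonneg _) hC0
        _ = C * ρ * |w y| := by ring
  have h_diff : ∀ᵐ y ∂(volume : Measure E), ∀ s' ∈ ball s 1,
      HasDerivAt (fun r => w y * η (x₀ + r • y)) (w y * fderiv ℝ η (x₀ + s' • y) y) s' := by
    refine Eventually.of_forall fun y s' _ => ?_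
    have h1 : HasDerivAt (fun r : ℝ => x₀ + r • y) y s' := by
      simpa using ((hasDerivAt_id s').smul_const y).const_add x₀
    have h2 := (hηd (x₀ + s' • y)).comp_hasDerivAt s' h1
    exact h2.const_mul (w y)
  exact (hasDerivAt_integral_of_dominated_loc_of_deriv_le (ball_mem_nhds s one_pos)
    (Eventually.of_forall hF_meas) hF_int hF'_meas h_bound
    ((hw.abs.integrable_of_hasCompactSupport hc.abs).const_mul (C * ρ)) h_diff).2

/-- **The derivative of `J` through the Laplacian.**  For `η ∈ C²(E)`, a weight `w` with a `C¹` compactly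
supported primitive `P` (`DP(y) = w(y)⟨y, ·⟩`) and `s ≠ 0`:
`∫ w(y) Dη(x₀ + s y)[y] dy = −s ∫ P(y) (Δη)(x₀ + s y) dy` — the core identity with Laplacian applied to
`η_s = η(x₀ + s ·)`, with `Dη_s(y)[y] = s Dη(x₀+sy)[y]` and `Δη_s(y) = s² (Δη)(x₀+sy)`. [folklore] -/
private theorem integral_mul_fderiv_comp_add_smul_eq_neg_mul_integral_laplacian {η w P : E → ℝ}
    (hη : ContDiff ℝ 2 η) (hP1 : ContDiff ℝ 1 P) (hPc : HasCompactSupport P)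
    (hP : ∀ y, HasFDerivAt P (w y • (innerSL ℝ y : E →L[ℝ] ℝ)) y) (x₀ : E) {s : ℝ} (hs : s ≠ 0) :
    ∫ y, w y * fderiv ℝ η (x₀ + s • y) y = -(s * ∫ y, P y * (Δ η) (x₀ + s • y)) := by
  set ηt : E → ℝ := fun z => η (x₀ + z) with hηt
  set ηs : E → ℝ := fun y => η (x₀ + s • y) with hηs
  have hηs2 : ContDiff ℝ 2 ηs := hη.comp (contDiff_const.add (contDiff_const_smul s))
  have core := integral_radial_mul_fderiv_apply_self_eq_neg_integral_mul_laplacian hηs2 hP1 hPc hP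
  have hfd : ∀ y, fderiv ℝ ηs y y = s * fderiv ℝ η (x₀ + s • y) y := fun y => by
    have h1 : ηs = fun y => ηt (s • y) := rfl
    rw [h1, _root_.fderiv_comp_smul, _root_.FunLike.coe_smul, Pi.smul_apply, smul_eq_mul, hηt,
      fderiv_comp_add_left]
  have hΔ : ∀ y, (Δ ηs) y = s ^ 2 * (Δ η) (x₀ + s • y) := fun y => by
    have h1 : ηs = fun y => (1 : ℝ) • ηt (s • y) := by
      funext y
      simp [hηs, hηt]
    rw [h1, laplacian_const_smul_comp_smul ηt 1 hs y, smul_eq_mul, one_mul, hηt,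
      laplacian_comp_const_add]
  have hl : ∫ y, w y * fderiv ℝ ηs y y = s * ∫ y, w y * fderiv ℝ η (x₀ + s • y) y := by
    rw [← integral_const_mul]
    refine integral_congr_ae (Eventually.of_forall fun y => ?_)
    dsimp only
    rw [hfd y]
    ring
  have hr : ∫ y, P y * (Δ ηs) y = s ^ 2 * ∫ y, P y * (Δ η) (x₀ + s • y) := by
    rw [← integral_const_mul]
    refine integral_congr_ae (Eventually.of_forall fun y => ?_)
    dsimp only
    rw [hΔ y]
    ring
  rw [hl, hr] at core
  have h2 : s * (∫ y, w y * fderiv ℝ η (x₀ + s • y) y) =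
      s * (-(s * ∫ y, P y * (Δ η) (x₀ + s • y))) := by
    rw [core]
    ring
  exact mul_left_cancel₀ hs h2

/-- **Continuity of a parametric integral whose integrands vanish off one compact set.**  If
`F : ℝ × E → ℝ` is jointly continuous and every `F(s, ·)` vanishes off a fixed compact `K`, then
`s ↦ ∫ F(s, y) dy` is continuous (Mathlib's `continuous_parametric_integral_of_continuous` on `K`). [folklore] -/
private theorem continuous_integral_of_eq_zero_off_compact {F : ℝ → E → ℝ} (hF : Continuous (uncurry F))
    {K : Set E} (hK : IsCompact K) (h0 : ∀ s, ∀ y, y ∉ K → F s y = 0) :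
    Continuous fun s => ∫ y, F s y := by
  have h : (fun s => ∫ y, F s y) = fun s => ∫ y in K, F s y := by
    funext s
    exact (setIntegral_eq_integral_of_forall_compl_eq_zero fun y hy => h0 s y hy).symm
  rw [h]
  exact continuous_parametric_integral_of_continuous hF hK

omit [FiniteDimensional ℝ E] [MeasurableSpace E] [BorelSpace E] in
/-- The map `(s, y) ↦ x₀ + s • y` is continuous. [folklore] -/
private theorem continuous_const_add_fst_smul_snd (x₀ : E) : Continuous fun p : ℝ × E => x₀ + p.1 • p.2 :=
  continuous_const.add (continuous_fst.smul continuous_snd)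

/-- Continuity of `s ↦ ∫ P(y) g(x₀ + s y) dy` for `P` continuous of compact support and `g` continuous.
[folklore] -/
private theorem continuous_integral_mul_comp_add_smul {P g : E → ℝ} (hPc' : Continuous P)
    (hPc : HasCompactSupport P) (hg : Continuous g) (x₀ : E) :
    Continuous fun s : ℝ => ∫ y, P y * g (x₀ + s • y) := by
  refine continuous_integral_of_eq_zero_off_compact (F := fun s y => P y * g (x₀ + s • y))
    ((hPc'.comp continuous_snd).mul (hg.comp (continuous_const_add_fst_smul_snd x₀))) hPc
    fun s y hy => ?_
  simp [image_eq_zero_of_notMem_tsupport hy]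

/-! ### The mean value defect identity -/

/-- **THE MEAN VALUE DEFECT IDENTITY.**  For `η ∈ C²(E)`, a continuous compactly supported weight `w` with a
`C¹` compactly supported primitive `P` (`DP(y) = w(y)⟨y, ·⟩`), and every centre `x₀`:
`∫ w(y) η(x₀ + y) dy − (∫ w) η(x₀) = −∫₀¹ s ∫ P(y) (Δη)(x₀ + s y) dy ds`.
For `Δη = 0` this is the weighted mean value property `integral_radial_mul_harmonic`.
[cite: GilbargTrudinger2001, Thm 2.1] -/
theorem integral_mul_comp_add_sub_integral_mul_eq {η w P : E → ℝ} (hη : ContDiff ℝ 2 η)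
    (hw : Continuous w) (hc : HasCompactSupport w) (hP1 : ContDiff ℝ 1 P) (hPc : HasCompactSupport P)
    (hP : ∀ y, HasFDerivAt P (w y • (innerSL ℝ y : E →L[ℝ] ℝ)) y) (x₀ : E) :
    (∫ y, w y * η (x₀ + y)) - (∫ y, w y) * η x₀ =
      -∫ s in (0 : ℝ)..1, s * ∫ y, P y * (Δ η) (x₀ + s • y) := by
  have hη1 : ContDiff ℝ 1 η := hη.of_le one_le_two
  set J : ℝ → ℝ := fun s => ∫ y, w y * η (x₀ + s • y) with hJ
  set J' : ℝ → ℝ := fun s => ∫ y, w y * fderiv ℝ η (x₀ + s • y) y with hJ'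
  have hderiv : ∀ s, HasDerivAt J (J' s) s := hasDerivAt_integral_mul_comp_add_smul hη1 hw hc x₀
  -- `J'` is continuous: jointly continuous integrand vanishing off `tsupport w`
  have hJ'c : Continuous J' := by
    refine continuous_integral_of_eq_zero_off_compact
      (F := fun s y => w y * fderiv ℝ η (x₀ + s • y) y) ?_ hc fun s y hy => ?_
    · exact (hw.comp continuous_snd).mul
        (((hη1.continuous_fderiv one_ne_zero).comp (continuous_const_add_fst_smul_snd x₀)).clm_apply
          continuous_snd)
    · simp [image_eq_zero_of_notMem_tsupport hy]
  have hFTC : ∫ s in (0 : ℝ)..1, J' s = J 1 - J 0 :=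
    intervalIntegral.integral_eq_sub_of_hasDerivAt (fun s _ => hderiv s) (hJ'c.intervalIntegrable 0 1)
  have hJ1 : J 1 = ∫ y, w y * η (x₀ + y) := by simp [hJ]
  have hJ0 : J 0 = (∫ y, w y) * η x₀ := by
    simp only [hJ, zero_smul, add_zero]
    exact integral_mul_const (η x₀) w
  -- on `(0, 1)` the derivative is the Laplacian integral
  have hcongr : ∫ s in (0 : ℝ)..1, J' s = ∫ s in (0 : ℝ)..1, -(s * ∫ y, P y * (Δ η) (x₀ + s • y)) :=
    intervalIntegral.integral_congr_Ioo_of_le zero_le_one fun s hs =>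
      integral_mul_fderiv_comp_add_smul_eq_neg_mul_integral_laplacian hη hP1 hPc hP x₀ hs.1.ne'
  rw [← hJ1, ← hJ0, ← hFTC, hcongr, intervalIntegral.integral_neg]

/-! ### The sub-mean-value inequality with defect -/

/-- **THE SUB-MEAN-VALUE INEQUALITY WITH DEFECT.**  Let `η ∈ C²(E)` with `Δη ≥ −f`, `f` continuous, and let `w`
be a continuous compactly supported weight with a NONPOSITIVE `C¹` compactly supported primitive `P`
(`DP(y) = w(y)⟨y, ·⟩`, `P ≤ 0`; e.g. a radial `w ≥ 0`, `exists_radial_primitive_nonpos`).  Then for every `x₀`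
`(∫ w) η(x₀) ≤ ∫ w(y) η(x₀ + y) dy + ∫₀¹ s ∫ (−P(y)) f(x₀ + s y) dy ds`.
For `f = 0`: a subharmonic function is dominated by its weighted averages (Gilbarg–Trudinger Thm 2.1, `Δu ≥ 0`).
[cite: GilbargTrudinger2001, Thm 2.1] -/
theorem integral_mul_le_integral_mul_comp_add_add {η w P f : E → ℝ} (hη : ContDiff ℝ 2 η)
    (hw : Continuous w) (hc : HasCompactSupport w) (hP1 : ContDiff ℝ 1 P) (hPc : HasCompactSupport P)
    (hP : ∀ y, HasFDerivAt P (w y • (innerSL ℝ y : E →L[ℝ] ℝ)) y) (hP0 : ∀ y, P y ≤ 0)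
    (hf : Continuous f) (hΔ : ∀ x, -f x ≤ (Δ η) x) (x₀ : E) :
    (∫ y, w y) * η x₀ ≤
      (∫ y, w y * η (x₀ + y)) + ∫ s in (0 : ℝ)..1, s * ∫ y, (-P y) * f (x₀ + s • y) := by
  have hid := integral_mul_comp_add_sub_integral_mul_eq hη hw hc hP1 hPc hP x₀
  have hPc' : Continuous P := hP1.continuous
  have hnPc' : Continuous fun y => -P y := hPc'.neg
  have hnPc : HasCompactSupport fun y => -P y := hPc.neg
  have hΔc : Continuous (Δ η) := FluidPDE.continuous_laplacian hη
  have haff : ∀ s : ℝ, Continuous fun y : E => x₀ + s • y := fun s =>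
    continuous_const.add (continuous_id.const_smul s)
  -- pointwise comparison of the `s`-integrands on `[0, 1]`
  have hmono : ∀ s ∈ Icc (0 : ℝ) 1,
      s * ∫ y, P y * (Δ η) (x₀ + s • y) ≤ s * ∫ y, (-P y) * f (x₀ + s • y) := by
    intro s hs
    refine mul_le_mul_of_nonneg_left ?_ hs.1
    refine integral_mono ?_ ?_ fun y => ?_
    · exact (hPc'.mul (hΔc.comp (haff s))).integrable_of_hasCompactSupport hPc.mul_right
    · exact (hnPc'.mul (hf.comp (haff s))).integrable_of_hasCompactSupport hnPc.mul_right
    · have h1 := mul_le_mul_of_nonpos_left (hΔ (x₀ + s • y)) (hP0 y)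
      simpa only [mul_neg, neg_mul] using h1
  have h1 : IntervalIntegrable (fun s : ℝ => s * ∫ y, P y * (Δ η) (x₀ + s • y)) volume 0 1 :=
    (continuous_id.mul (continuous_integral_mul_comp_add_smul hPc' hPc hΔc x₀)).intervalIntegrable 0 1
  have h2 : IntervalIntegrable (fun s : ℝ => s * ∫ y, (-P y) * f (x₀ + s • y)) volume 0 1 :=
    (continuous_id.mul (continuous_integral_mul_comp_add_smul hnPc' hnPc hf x₀)).intervalIntegrable 0 1
  have hle := intervalIntegral.integral_mono_on zero_le_one h1 h2 hmono
  linarith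

/-! ### Unit-mass form for the radial probe bumps `probeBump R` -/

/-- **THE SUB-MEAN-VALUE INEQUALITY FOR PROBE BUMPS.**  Let `η ∈ C²(E)` with `Δη ≥ −f`, `f` continuous, `R > 0`,
and let `χ_R = probeBump R` be the tree's unit-mass radial bump (`= (m R^d)⁻¹` on `‖y‖ ≤ R`, supported in
`‖y‖ ≤ 2R`, `∫ χ_R = 1`).  Then there is a continuous `Q : E → ℝ` with `0 ≤ Q ≤ 2R²(m R^d)⁻¹`, `Q(y) = 0` for
`‖y‖ ≥ 2R` (namely `Q = −P`, `P` the signed radial primitive of `χ_R`), such that for every centre `x₀`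
`η(x₀) ≤ ∫ χ_R(y) η(x₀ + y) dy + ∫₀¹ s ∫ Q(y) f(x₀ + s y) dy ds`.
[cite: GilbargTrudinger2001, Thm 2.1] -/
theorem le_integral_probeBump_mul_comp_add_add {η f : E → ℝ} (hη : ContDiff ℝ 2 η)
    (hf : Continuous f) (hΔ : ∀ x, -f x ≤ (Δ η) x) {R : ℝ} (hR : 0 < R) :
    ∃ Q : E → ℝ, Continuous Q ∧ (∀ y, 0 ≤ Q y) ∧ (∀ y, 2 * R ≤ ‖y‖ → Q y = 0) ∧
      (∀ y, Q y ≤ 2 * R ^ 2 * (baseBumpMass E * R ^ Module.finrank ℝ E)⁻¹) ∧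
      ∀ x₀ : E, η x₀ ≤ (∫ y, probeBump R y * η (x₀ + y)) + ∫ s in (0 : ℝ)..1, s * ∫ y, Q y * f (x₀ + s • y) := by
  set M : ℝ := (baseBumpMass E * R ^ Module.finrank ℝ E)⁻¹ with hMdef
  have hw : Continuous (probeBump (E := E) R) := (contDiff_probeBump R (n := 0)).continuous
  have hwM : ∀ x : E, probeBump R x ≤ M := fun x => (le_abs_self _).trans (abs_probeBump_le hR x)
  obtain ⟨P, hP1, hPc, hP, hPle, hP0, -, hPcoarse⟩ :=
    exists_radial_primitive_nonpos hw (fun x y h => probeBump_radial R h) (probeBump_nonneg hR) hwM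
      (by positivity : (0 : ℝ) < 2 * R) (fun x hx => probeBump_eq_zero hR hx)
  refine ⟨fun y => -P y, hP1.continuous.neg, fun y => neg_nonneg.2 (hPle y),
    fun y hy => show -P y = 0 by rw [hP0 y hy, neg_zero], fun y => (hPcoarse y).trans (le_of_eq ?_),
    fun x₀ => ?_⟩
  · rw [hMdef]
    ring
  · have h := integral_mul_le_integral_mul_comp_add_add hη hw (hasCompactSupport_probeBump hR) hP1 hPc hP
      hPle hf hΔ x₀
    rwa [integral_probeBump hR, one_mul] at h


/-- **THE EXACT DEFECT IDENTITY FOR THE PROBE BUMP.**  For every `C²` function `η` and radius `R > 0` there is an explicit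
kernel `Q ≥ 0`, continuous, supported in `‖y‖ ≤ 2R`, bounded by `2R²·(m R^d)⁻¹` (`m = baseBumpMass E`), such that for
every centre `x₀`
`η(x₀) − ∫ χ_R(y) η(x₀ + y) dy = ∫₀¹ s ∫ Q(y) · (−Δη)(x₀ + s y) dy ds`
(`χ_R = probeBump R`, unit mass): the mean-value DEFECT of `η` at `x₀` is a positive average of `−Δη` over the ball `B_{2R}(x₀)`
— the equality case behind `le_integral_probeBump_mul_comp_add_add`. [cite: GilbargTrudinger2001, Thm. 2.1 (proof, Green representation)] -/
theorem exists_probeBump_defect_eq {η : E → ℝ} (hη : ContDiff ℝ 2 η) {R : ℝ} (hR : 0 < R) :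
    ∃ Q : E → ℝ, Continuous Q ∧ (∀ y, 0 ≤ Q y) ∧ (∀ y, 2 * R ≤ ‖y‖ → Q y = 0) ∧
      (∀ y, Q y ≤ 2 * R ^ 2 * (baseBumpMass E * R ^ Module.finrank ℝ E)⁻¹) ∧
      ∀ x₀ : E, η x₀ - (∫ y, probeBump R y * η (x₀ + y)) =
        ∫ s in (0 : ℝ)..1, s * ∫ y, Q y * (-(Δ η) (x₀ + s • y)) := by
  set M : ℝ := (baseBumpMass E * R ^ Module.finrank ℝ E)⁻¹ with hMdef
  have hw : Continuous (probeBump (E := E) R) := (contDiff_probeBump R (n := 0)).continuous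
  have hwM : ∀ x : E, probeBump R x ≤ M := fun x => (le_abs_self _).trans (abs_probeBump_le hR x)
  obtain ⟨P, hP1, hPc, hP, hPle, hP0, -, hPcoarse⟩ :=
    exists_radial_primitive_nonpos hw (fun x y h => probeBump_radial R h) (probeBump_nonneg hR) hwM
      (by positivity : (0 : ℝ) < 2 * R) (fun x hx => probeBump_eq_zero hR hx)
  refine ⟨fun y => -P y, hP1.continuous.neg, fun y => neg_nonneg.2 (hPle y),
    fun y hy => show -P y = 0 by rw [hP0 y hy, neg_zero], fun y => (hPcoarse y).trans (le_of_eq ?_),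
    fun x₀ => ?_⟩
  · rw [hMdef]
    ring
  · have hid := integral_mul_comp_add_sub_integral_mul_eq hη hw (hasCompactSupport_probeBump hR) hP1 hPc hP x₀
    rw [integral_probeBump hR, one_mul] at hid
    have e : ∀ s : ℝ, (∫ y, -P y * -(Δ η) (x₀ + s • y)) = ∫ y, P y * (Δ η) (x₀ + s • y) := fun s => by
      refine integral_congr_ae (Eventually.of_forall fun y => ?_)
      simp only [neg_mul_neg]
    simp_rw [e]
    linarith

end Volume

end Literature.Analysis.FluidPDE

end
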